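import Summits.AtomisticToContinuum.FouriersLaw.Theses.BondHeatUncertainty
import Summits.AtomisticToContinuum.FouriersLaw.Theorems.ExtensiveSnapshotIrreversibility.Negative.DegenerateInstances

/-!
# `ExtensiveSnapshotIrreversibility` — family independence and normalisation robustness
(structural lemmas, cdisprove cycle 2)

Support file for crux item `stmt-AtomisticToContinuum-9121` (route `BondHeatUncertainty`, decl
`ExtensiveSnapshotIrreversibility`).  The crux quantifies over EVERY steady-state family `μ`
under the weak-NESS uniqueness guard.  Two bookkeeping facts a prover (or a refuter) may use
without re-deriving them; none asserts the crux.

* `extensiveSnapshotIrreversibility_family_eventuallyEq`: under the guard, two steady-state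
  families agree along `(T + δ/2, T - δ/2)` for `δ` near `0` (both bath temperatures are then
  positive and the weak steady state is unique), hence
  `extensiveSnapshotIrreversibility_concl_iff_of_uniq`: the conclusion of the crux at mean
  temperature `T`, with a given constant `C`, holds for one family iff it holds for any other, and
  `extensiveSnapshotIrreversibility_concl_of_exists_family`: it suffices to establish the bound
  along ONE steady-state family (e.g. the CEHR invariant measures) — the universal quantifier
  over families carries no extra content.  Conversely a counterexample may be sought along any
  convenient family.
* `extensiveSnapshotIrreversibility_perBond_iff_perSite`: the per-bond (`C·(N-1)·δ²`) and
  per-site (`C·N·δ²`) extensive bounds are equivalent under the crux hypotheses (the `N = 0, 1`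
  instances hold with constant `0`: `extensiveSnapshotIrreversibility_bound_at_zero/_at_one`), so
  "extensive" is insensitive to the normalisation and only `N ≥ 2` carries content.
-/

namespace Summit.AtomisticToContinuum.FouriersLaw.Theorems.ExtensiveSnapshotIrreversibility.Negative

open MeasureTheory Filter Topology InformationTheory
open scoped ENNReal
open Literature.MathematicalPhysics.KineticTheory.HeatConduction

variable {ω₂ lam β γ : ℝ}

/-- Under the uniqueness guard two steady-state families agree along `T ± δ/2` for `δ` near `0`.
[folklore] -/
theorem extensiveSnapshotIrreversibility_family_eventuallyEq
    (hU : ∀ (N : ℕ) (T_L T_R : ℝ), 0 < T_L → 0 < T_R → ∀ μ ν : Measure (PhaseSpace N),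
      (pinnedChain ω₂ lam β γ).IsSteadyState N T_L T_R μ →
      (pinnedChain ω₂ lam β γ).IsSteadyState N T_L T_R ν → μ = ν)
    {μ ν : (N : ℕ) → ℝ → ℝ → Measure (PhaseSpace N)}
    (hμ : ∀ (N : ℕ) (T_L T_R : ℝ), 0 < T_L → 0 < T_R →
      (pinnedChain ω₂ lam β γ).IsSteadyState N T_L T_R (μ N T_L T_R))
    (hν : ∀ (N : ℕ) (T_L T_R : ℝ), 0 < T_L → 0 < T_R →
      (pinnedChain ω₂ lam β γ).IsSteadyState N T_L T_R (ν N T_L T_R))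
    {T : ℝ} (hT : 0 < T) (N : ℕ) :
    ∀ᶠ δ in 𝓝[≠] (0 : ℝ), μ N (T + δ / 2) (T - δ / 2) = ν N (T + δ / 2) (T - δ / 2) := by
  filter_upwards [eventually_bath_temps_pos hT] with δ hδ
  exact hU N _ _ hδ.1 hδ.2 _ _ (hμ N _ _ hδ.1 hδ.2) (hν N _ _ hδ.1 hδ.2)

/-- **Family independence of the conclusion.**  Under the guard, the conclusion of
`ExtensiveSnapshotIrreversibility` at mean temperature `T` with constant `C` holds for one
steady-state family iff it holds for any other. [folklore] -/
theorem extensiveSnapshotIrreversibility_concl_iff_of_uniq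
    (hU : ∀ (N : ℕ) (T_L T_R : ℝ), 0 < T_L → 0 < T_R → ∀ μ ν : Measure (PhaseSpace N),
      (pinnedChain ω₂ lam β γ).IsSteadyState N T_L T_R μ →
      (pinnedChain ω₂ lam β γ).IsSteadyState N T_L T_R ν → μ = ν)
    {μ ν : (N : ℕ) → ℝ → ℝ → Measure (PhaseSpace N)}
    (hμ : ∀ (N : ℕ) (T_L T_R : ℝ), 0 < T_L → 0 < T_R →
      (pinnedChain ω₂ lam β γ).IsSteadyState N T_L T_R (μ N T_L T_R))
    (hν : ∀ (N : ℕ) (T_L T_R : ℝ), 0 < T_L → 0 < T_R →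
      (pinnedChain ω₂ lam β γ).IsSteadyState N T_L T_R (ν N T_L T_R))
    {T : ℝ} (hT : 0 < T) (C : ℝ) :
    (∀ N : ℕ, ∀ᶠ δ in 𝓝[≠] (0 : ℝ),
      klDiv (μ N (T + δ / 2) (T - δ / 2))
        (Measure.map (fun x : PhaseSpace N => (x.1, -x.2)) (μ N (T + δ / 2) (T - δ / 2)))
          ≤ ENNReal.ofReal (C * (N : ℝ) * δ ^ 2)) ↔
    (∀ N : ℕ, ∀ᶠ δ in 𝓝[≠] (0 : ℝ),
      klDiv (ν N (T + δ / 2) (T - δ / 2))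
        (Measure.map (fun x : PhaseSpace N => (x.1, -x.2)) (ν N (T + δ / 2) (T - δ / 2)))
          ≤ ENNReal.ofReal (C * (N : ℝ) * δ ^ 2)) := by
  constructor <;> intro hC N
  · filter_upwards [hC N, extensiveSnapshotIrreversibility_family_eventuallyEq hU hμ hν hT N]
      with δ h1 h2
    rw [← h2]
    exact h1
  · filter_upwards [hC N, extensiveSnapshotIrreversibility_family_eventuallyEq hU hμ hν hT N]
      with δ h1 h2
    rw [h2]
    exact h1

/-- **It suffices to prove the bound along ONE steady-state family.**  Under the guard, if some
steady-state family satisfies the conclusion of the crux at every `T > 0`, then every steady-state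
family does (with the same constants). [folklore] -/
theorem extensiveSnapshotIrreversibility_concl_of_exists_family
    (hU : ∀ (N : ℕ) (T_L T_R : ℝ), 0 < T_L → 0 < T_R → ∀ μ ν : Measure (PhaseSpace N),
      (pinnedChain ω₂ lam β γ).IsSteadyState N T_L T_R μ →
      (pinnedChain ω₂ lam β γ).IsSteadyState N T_L T_R ν → μ = ν)
    (hex : ∃ μ : (N : ℕ) → ℝ → ℝ → Measure (PhaseSpace N),
      (∀ (N : ℕ) (T_L T_R : ℝ), 0 < T_L → 0 < T_R →
        (pinnedChain ω₂ lam β γ).IsSteadyState N T_L T_R (μ N T_L T_R)) ∧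
      ∀ T : ℝ, 0 < T → ∃ C : ℝ, ∀ N : ℕ, ∀ᶠ δ in 𝓝[≠] (0 : ℝ),
        klDiv (μ N (T + δ / 2) (T - δ / 2))
          (Measure.map (fun x : PhaseSpace N => (x.1, -x.2)) (μ N (T + δ / 2) (T - δ / 2)))
            ≤ ENNReal.ofReal (C * (N : ℝ) * δ ^ 2))
    (ν : (N : ℕ) → ℝ → ℝ → Measure (PhaseSpace N))
    (hν : ∀ (N : ℕ) (T_L T_R : ℝ), 0 < T_L → 0 < T_R →
      (pinnedChain ω₂ lam β γ).IsSteadyState N T_L T_R (ν N T_L T_R))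
    {T : ℝ} (hT : 0 < T) :
    ∃ C : ℝ, ∀ N : ℕ, ∀ᶠ δ in 𝓝[≠] (0 : ℝ),
      klDiv (ν N (T + δ / 2) (T - δ / 2))
        (Measure.map (fun x : PhaseSpace N => (x.1, -x.2)) (ν N (T + δ / 2) (T - δ / 2)))
          ≤ ENNReal.ofReal (C * (N : ℝ) * δ ^ 2) := by
  obtain ⟨μ, hμ, hCμ⟩ := hex
  obtain ⟨C, hC⟩ := hCμ T hT
  exact ⟨C, (extensiveSnapshotIrreversibility_concl_iff_of_uniq hU hμ hν hT C).1 hC⟩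

/-- **Normalisation robustness**: under the hypotheses of the crux, a per-bond extensive bound
`KL ≤ C·(N-1)·δ²` and a per-site one `KL ≤ C·N·δ²` are equivalent (the instances `N = 0, 1` hold
with constant `0` by `extensiveSnapshotIrreversibility_bound_at_zero/_at_one`; for `N ≥ 2`,
`N - 1 ≤ N ≤ 2(N - 1)`). [folklore] -/
theorem extensiveSnapshotIrreversibility_perBond_iff_perSite (hω : 0 < ω₂) (hl : 0 < lam)
    (hβ : 0 < β)
    (hU : ∀ (N : ℕ) (T_L T_R : ℝ), 0 < T_L → 0 < T_R → ∀ μ ν : Measure (PhaseSpace N),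
      (pinnedChain ω₂ lam β γ).IsSteadyState N T_L T_R μ →
      (pinnedChain ω₂ lam β γ).IsSteadyState N T_L T_R ν → μ = ν)
    {μ : (N : ℕ) → ℝ → ℝ → Measure (PhaseSpace N)}
    (hμ : ∀ (N : ℕ) (T_L T_R : ℝ), 0 < T_L → 0 < T_R →
      (pinnedChain ω₂ lam β γ).IsSteadyState N T_L T_R (μ N T_L T_R))
    {T : ℝ} (hT : 0 < T) :
    (∃ C : ℝ, ∀ N : ℕ, ∀ᶠ δ in 𝓝[≠] (0 : ℝ),
      klDiv (μ N (T + δ / 2) (T - δ / 2))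
        (Measure.map (fun x : PhaseSpace N => (x.1, -x.2)) (μ N (T + δ / 2) (T - δ / 2)))
          ≤ ENNReal.ofReal (C * ((N : ℝ) - 1) * δ ^ 2)) ↔
    (∃ C : ℝ, ∀ N : ℕ, ∀ᶠ δ in 𝓝[≠] (0 : ℝ),
      klDiv (μ N (T + δ / 2) (T - δ / 2))
        (Measure.map (fun x : PhaseSpace N => (x.1, -x.2)) (μ N (T + δ / 2) (T - δ / 2)))
          ≤ ENNReal.ofReal (C * (N : ℝ) * δ ^ 2)) := by
  constructor
  · rintro ⟨C, hC⟩
    refine ⟨max C 0, fun N => ?_⟩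
    rcases Nat.eq_zero_or_pos N with rfl | hN
    · exact extensiveSnapshotIrreversibility_bound_at_zero hμ hT _
    · filter_upwards [hC N] with δ hδ
      refine hδ.trans (ENNReal.ofReal_le_ofReal ?_)
      have h1 : (1 : ℝ) ≤ N := by exact_mod_cast hN
      have hδ2 : 0 ≤ δ ^ 2 := sq_nonneg δ
      have hm : C ≤ max C 0 := le_max_left _ _
      have hm0 : 0 ≤ max C 0 := le_max_right _ _
      nlinarith [mul_nonneg hm0 hδ2, mul_nonneg (sub_nonneg.2 hm)
        (mul_nonneg (by linarith : (0:ℝ) ≤ (N:ℝ) - 1) hδ2)]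
  · rintro ⟨C, hC⟩
    refine ⟨2 * max C 0, fun N => ?_⟩
    rcases Nat.lt_or_ge N 2 with hN | hN
    · interval_cases N
      · filter_upwards [extensiveSnapshotIrreversibility_bound_at_zero hμ hT 0] with δ hδ
        exact hδ.trans (by simp)
      · filter_upwards [extensiveSnapshotIrreversibility_bound_at_one hω hl hβ hU hμ hT 0]
          with δ hδ
        exact hδ.trans (by simp)
    · filter_upwards [hC N] with δ hδ
      refine hδ.trans (ENNReal.ofReal_le_ofReal ?_)
      have h2 : (2 : ℝ) ≤ N := by exact_mod_cast hN
      have hδ2 : 0 ≤ δ ^ 2 := sq_nonneg δ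
      have hm : C ≤ max C 0 := le_max_left _ _
      have hm0 : 0 ≤ max C 0 := le_max_right _ _
      nlinarith [mul_nonneg hm0 hδ2, mul_nonneg (sub_nonneg.2 hm)
        (mul_nonneg (by linarith : (0:ℝ) ≤ (N:ℝ)) hδ2),
        mul_nonneg (mul_nonneg hm0 (by linarith : (0:ℝ) ≤ (N:ℝ) - 2)) hδ2]

end Summit.AtomisticToContinuum.FouriersLaw.Theorems.ExtensiveSnapshotIrreversibility.Negative
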